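import Summits.QuantumFields.YangMills.Theorems.UnitScaleTiltProp7H88DoorOfH137H133
import Summits.QuantumFields.YangMills.Theorems.UnitScaleTiltProp7H133FamilyPackage
import Summits.QuantumFields.YangMills.Theorems.UnitScaleTiltProp7GreenPiBlockLettersEdition
import HarnessLib

/-!
# Route `UnitScaleTilt`, crux K1 «MinimiserStabilityRegPr» (stmt-QuantumFields-19200), EX row (4) `h88` — **(K-h88) THE ROW (4) `∃`-PACKAGE: S47's `h88` ROW TEXT FOR ALL MEMBERS WITH
# L-ONLY CAP ∕ CONSTANT ∕ RATE, FROM ROWS (1)(3)'s PACKAGES (✓p776003) AND THE (c4b)-FAMILY** — the h88-DOOR ✓p775556 `Prop7H88DoorOfH137H133.h88_family_of_h137k_h133_c4w` fed BY NAME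
# with px10 g14's ✓`Prop7H133FamilyPackage.h133_family_exists`∕`h137kpi_family_exists`, the (γ) package ✓`Prop7OneFormCoerciveHolds.hco_DeltaPiSlotP_exists`, and ONE displayed
# `∃`-package `hC4b` = the BLOCK-SUPPORTED family edition of (c4) (✓p775668 `hc4b_of_letters`' text at every member; px5 g15's (c4)-FAMILY), read as the door's weighted letter by
# D3's abstract ✓`Prop7GreenPiBlockLettersEdition.weighted_of_blockSupported` (block at rate `δ₄` ⟹ weighted at every rate `≤ δ₄∕2`, `×(2(1+2∕δ₄))³`).  ★p1 g28 CHAIR CLAIM 14:49Z.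

Cell `ym3-torus` (HUMAN RULING D-0037; rung R3 = SU(2) YM₃ on T³ — NOT d = 4, NOT infinite volume, NOT a mass gap, NOT Clay).  Fleet lead ∕ chair seat `ym-ust-19200-p1` (gen 28).
THEOREMS ONLY (0 `def`, 0 `sorry`, default heartbeats — §2 measured inside 100 000); `--supports stmt-QuantumFields-19200 --as helper`; count-neutral.

WHAT IS PROVED (ns `…Theorems.Prop7H88FamilyPackage`).
* §1 ★ `hc4w_of_hc4b` — the block-supported (c4) letter at `(C₄, δ₄)` ⟹ the weighted (c4) letter (the door's `hc4w` text) at every rate `0 ≤ δ ≤ δ₄∕2` with `C₄·(2(1+2∕δ₄))³`.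
* §2 ★★★ **`h88_family_exists_of_c4bFamily`** — `(hC4b : ∃ αC C₄ δ₄, … ∀ L>1 i U₀ ρ, RegPr → ρ ≤ αC L → Lift → ∀ a′ ≥ 0, ⟨(c4b) text at (C₄ L, δ₄ L)⟩)` (R2 ✓`hc2b_family_allMembers`' shape with the
  (c4) operator `D_{U₀}(R_S(G′ᴾ_{a′}(toL2S v)))`) ⟹ `∃ (αΔ CΔ δΔ : ℕ → ℝ), (0 < αΔ L) ∧ (10¹²L³αΔ ≤ 1) ∧ (10¹⁰L⁶αΔ ≤ 1) ∧ (13·10¹⁴L³αΔ ≤ 1) ∧ (αΔ ≤ 1) ∧ (0 ≤ CΔ L) ∧ (0 < δΔ L) ∧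
  ∀ L>1 i U₀ ρ, RegPr → ρ ≤ αΔ L → Lift → ROOM → ∀ a ∈ [a₀,a₁]·(c₀ L∕cB L)ℓ³ → ⟨S47's `h88` ROW TEXT at (CΔ L, δΔ L)⟩` — `h133_family_exists`' `∃`-head and antecedent order VERBATIM.
HYP-SAT (★★OWNER RULING №42).  `hC4b` is a displayed `∃`-package whose member text is ✓p775668 `hc4b_of_letters`' conclusion (supplier: px5 g15's (c4)-PIN∕MEMBER∕FAMILY over ✓W5a, ✓R1∕R2 §1,
✓p775628 `hsrcW_pin`); rows (1)(3) and (γ) are TREE packages; ROOM rides only on rows (1)(3)'s packages (η-interpolant wrap; (R6) px5 removes it and this file re-runs two tokens lighter).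
HONEST SCOPE.  Packaging of landed doors; CONDITIONAL on `hC4b`; nothing of (c4)'s pin, h88's print content, the other EX rows, EX or the crux is proved here; the Yang–Mills mass gap is NOT proved.

References: T. Bałaban, CMP **102** (1985) 277–309 [Balaban1985Variational] ((88) p.291, (137)–(139) pp.298–299); CMP **99** (1985) 389–434 [Balaban1985BackgroundPropagators]
((3.117) p.419, (3.133) p.422, Thm 3.12 p.423, (3.25) p.394).
-/

set_option autoImplicit false

noncomputable section

open scoped BigOperators Matrix.Norms.L2Operator InnerProductSpace ComplexConjugate

namespace Summit.QuantumFields.YangMills.Theorems.Prop7H88FamilyPackage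

open Literature.MathematicalPhysics.QuantumFieldTheory.Balaban1983to89
open Literature.MathematicalPhysics.QuantumFieldTheory.Balaban1983to89.T3ContinuumYM3Torus
open Literature.MathematicalPhysics.QuantumFieldTheory.Balaban1983to89.T3Thm1Carrier
open Literature.MathematicalPhysics.QuantumFieldTheory.Balaban1983to89.B9Eq3119DeltaPiCarrier (currentCLM)
open T3PrintedRegularMinimiser (RegPr)
open T3PrintedMinimiserExistence (regPr_mono)
open T3PrintedRegularOrbits (sites_eq)
open T3LevelShift (siteShift)
open T3SectALandauChart (bgUnits)
open B15DeterminingSets (embIter)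
open B9SectCLatticeCarrier (Bond)
open B9Eq311L2Pairing (WL2)
open B11Eq103H1Complex (BondL2K)
open B11Eq115Space (NegSize Space115 JetSup NegSup levWeight)
open B11Eq111FrakG (nabla115)
open B11Eq90V0primeCurrent (flat115)
open B5Eq118OneStroke (iterBlockOf)
open Summit.QuantumFields.YangMills.Theorems.Prop8Chart (emlIterU)
open Summit.QuantumFields.YangMills.Theorems.Prop7SectET3Transport (periodsT3 bondEquiv bgOfCfg)
open Summit.QuantumFields.YangMills.Theorems.Prop7SectET3HilbertLetters (W₂ frobEquiv toL2 toL2S toL2B DL2)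
open Summit.QuantumFields.YangMills.Theorems.Prop7SectET3GaugeProjector (RS)
open Summit.QuantumFields.YangMills.Theorems.Prop7SectET3WilsonHessian (DeltaEtaSlot)
open Summit.QuantumFields.YangMills.Theorems.Prop7SectET3CurvedPropagators (Qk KinvT H1f PosOnto)
open Summit.QuantumFields.YangMills.Theorems.Prop7SectET3DeltaPiPInv (GprimeP DeltaPiSlotP)
open Summit.QuantumFields.YangMills.Theorems.Prop7OneFormCoerciveHolds (hco_DeltaPiSlotP_exists posOnto_of_coercive)
open Summit.QuantumFields.YangMills.Theorems.Prop7H133FamilyPackage (h133_family_exists h137kpi_family_exists)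
open Summit.QuantumFields.YangMills.Theorems.Prop7GreenPiBlockLettersEdition (weighted_of_blockSupported)
open Summit.QuantumFields.YangMills.Theorems.Prop7H88DoorOfH137H133 (h88_family_of_h137k_h133_c4w)

/-! ## §1 The block-supported (c4) letter read as the door's weighted letter -/

/-- ★ **(c4b) ⟹ (c4w) AT HALF THE RATE OR LESS**: a block-supported row of `v ↦ toL2⁻¹(D_{U₀}(R_S(G′ᴾ_{a′}(toL2S v))))` at `(C₄, δ₄)` gives the door's weighted letter at every
`0 ≤ δ ≤ δ₄∕2` with constant `C₄·(2(1+2∕δ₄))³` — D3's abstract ✓`weighted_of_blockSupported` at `ν := δ₄∕2` (the operator is additive in `v`).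
[cite: Balaban1985BackgroundPropagators, Thm 3.1 (3.42) p.397, (3.25) p.394; Balaban1985Averaging, (2) p.17] -/
theorem hc4w_of_hc4b (F : T3Family) {n K : ℕ} (h : n ≤ K) (c₀ cB : ℝ) [Fact (0 < c₀)] [Fact (0 < cB)] (a' : ℝ)
    (U₀ : GaugeField (F.P K) 0 (Matrix.specialUnitaryGroup (Fin 2) ℂ)) {C₄ δ₄ δ : ℝ} (hC₄ : 0 ≤ C₄) (hδ₄ : 0 < δ₄) (hδ : 0 ≤ δ) (hδle : δ ≤ δ₄ / 2)
    (hc4b : ∀ (v : Site (F.P K) 0 → Matrix (Fin 2) (Fin 2) ℂ) (z : Site (F.P K) (K - n)), (∀ y, v y ≠ 0 → iterBlockOf (K - n) y = z) →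
      ∀ m : ℝ, 0 ≤ m → (∀ y, ‖v y‖ ≤ m) →
        ∀ b : PBond (F.P K) 0, ‖(toL2 F K c₀).symm (DL2 F n K c₀ U₀ (RS F n K h c₀ cB U₀ (GprimeP F n K h c₀ cB a' U₀ (toL2S F K c₀ v)))) b‖
          ≤ m * C₄ * Real.exp (-(δ₄ * (Site.tdist (P := F.P K) (iterBlockOf (K - n) b.src) z : ℝ)))) :
    ∀ (z : Site (F.P K) (K - n)) (v : Site (F.P K) 0 → Matrix (Fin 2) (Fin 2) ℂ) (m : ℝ), 0 ≤ m →
      (∀ x, ‖v x‖ ≤ m * Real.exp (-(δ * (Site.tdist (P := F.P K) (iterBlockOf (K - n) x) z : ℝ)))) →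
      ∀ b : PBond (F.P K) 0, ‖(toL2 F K c₀).symm (DL2 F n K c₀ U₀ (RS F n K h c₀ cB U₀ (GprimeP F n K h c₀ cB a' U₀ (toL2S F K c₀ v)))) b‖
        ≤ (C₄ * (2 * (1 + 2 / δ₄)) ^ 3) * m * Real.exp (-(δ * (Site.tdist (P := F.P K) (iterBlockOf (K - n) b.src) z : ℝ))) := by
  intro z v m hm hv b
  have hν : 0 < δ₄ / 2 := by linarith
  have hδ₁ : δ + δ₄ / 2 ≤ δ₄ := by linarith
  have hadd : ∀ f : Site (F.P K) (K - n) → Site (F.P K) 0 → Matrix (Fin 2) (Fin 2) ℂ,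
      (fun w : Site (F.P K) 0 → Matrix (Fin 2) (Fin 2) ℂ => (toL2 F K c₀).symm (DL2 F n K c₀ U₀ (RS F n K h c₀ cB U₀ (GprimeP F n K h c₀ cB a' U₀ (toL2S F K c₀ w))))) (∑ z', f z')
        = ∑ z', (fun w : Site (F.P K) 0 → Matrix (Fin 2) (Fin 2) ℂ => (toL2 F K c₀).symm (DL2 F n K c₀ U₀ (RS F n K h c₀ cB U₀ (GprimeP F n K h c₀ cB a' U₀ (toL2S F K c₀ w))))) (f z') := by
    intro f
    simp only [map_sum]
  have key := weighted_of_blockSupported (F := F) (n := n) (K := K) (fun y : Site (F.P K) 0 => iterBlockOf (K - n) y) (fun b : PBond (F.P K) 0 => iterBlockOf (K - n) b.src)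
    (fun w : Site (F.P K) 0 → Matrix (Fin 2) (Fin 2) ℂ => (toL2 F K c₀).symm (DL2 F n K c₀ U₀ (RS F n K h c₀ cB U₀ (GprimeP F n K h c₀ cB a' U₀ (toL2S F K c₀ w)))))
    hadd hC₄ hδ hν hδ₁ hc4b z v m hm hv b
  have e2 : (2 * (1 + 1 / (δ₄ / 2))) = 2 * (1 + 2 / δ₄) := by field_simp
  rw [e2] at key
  calc _ ≤ _ := key
    _ = _ := by ring

/-! ## §2 ★★★ The row (4) `∃`-package from rows (1)(3)'s packages and the (c4b)-family -/

/-- ★★★ **THE S47 ROW `h88` FOR ALL MEMBERS AS ONE `∃`-PACKAGE, MODULO THE (c4b)-FAMILY** (cap `αΔ`, constant `CΔ L`, rate `δΔ L`; thread `Lift ∧ ROOM ∧` coupling window — the `∃`-head and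
antecedents of ✓`h133_family_exists` VERBATIM): h88-DOOR ✓p775556 §3 ∘ {✓`h133_family_exists`, ✓`h137kpi_family_exists`, (γ) ✓`hco_DeltaPiSlotP_exists`, `hC4b` via §1}, rates aligned to
`δΔ := min (min δK (δH∕2)) (δ₄∕2)`. [cite: Balaban1985Variational, (88) p.291, (137)–(138) pp.298–299; Balaban1985BackgroundPropagators, (3.117) p.419, (3.133) p.422, Thm 3.12 p.423] -/
theorem h88_family_exists_of_c4bFamily [hFL : ∀ F : T3Family, Fact (0 < (F.L : ℝ))] [hFη : ∀ (F : T3Family) (k : ℕ), Fact (0 < ((F.L : ℝ)⁻¹) ^ k)]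
    (c₀ cB : ℕ → ℝ) [hc₀ : ∀ L : ℕ, Fact (0 < c₀ L)] [hcB : ∀ L : ℕ, Fact (0 < cB L)] {a₀ a₁ : ℝ} (ha₀ : 0 < a₀) (ha₀₁ : a₀ ≤ a₁)
    (hC4b : ∃ αC C₄ δ₄ : ℕ → ℝ,
      (∀ L : ℕ, 1 < L → 0 < αC L ∧ 10 ^ 12 * (L : ℝ) ^ 3 * αC L ≤ 1) ∧ (∀ L : ℕ, 1 < L → 0 ≤ C₄ L) ∧ (∀ L : ℕ, 0 < δ₄ L) ∧
      ∀ (L : ℕ), 1 < L → ∀ (i : Idx L) (U₀ : GaugeField (i.1.1.P i.1.2.2) 0 (Matrix.specialUnitaryGroup (Fin 2) ℂ)), ∀ ρ : ℝ,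
        RegPr i.1.1 i.1.2.1 i.1.2.2 ρ U₀ → ρ ≤ αC L →
      (∀ cf : Site (i.1.1.P i.1.2.2) (i.1.2.2 - i.1.2.1) → Matrix (Fin 2) (Fin 2) ℂ,
      (∀ e : PBond (i.1.1.P i.1.2.2) (i.1.2.2 - i.1.2.1), cf e.src = ((emlIterU (i.1.2.2 - i.1.2.1) (bgUnits i.1.1 i.1.2.2 U₀) e : (Matrix (Fin 2) (Fin 2) ℂ)ˣ) : Matrix (Fin 2) (Fin 2) ℂ) * cf e.tgt *
        (((emlIterU (i.1.2.2 - i.1.2.1) (bgUnits i.1.1 i.1.2.2 U₀) e)⁻¹ : (Matrix (Fin 2) (Fin 2) ℂ)ˣ) : Matrix (Fin 2) (Fin 2) ℂ)) →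
      ∃ l₀ : Site (i.1.1.P i.1.2.2) 0 → Matrix (Fin 2) (Fin 2) ℂ,
        (∀ b : PBond (i.1.1.P i.1.2.2) 0, l₀ b.src = ((bgUnits i.1.1 i.1.2.2 U₀ b : (Matrix (Fin 2) (Fin 2) ℂ)ˣ) : Matrix (Fin 2) (Fin 2) ℂ) * l₀ b.tgt * (((bgUnits i.1.1 i.1.2.2 U₀ b)⁻¹ : (Matrix (Fin 2) (Fin 2) ℂ)ˣ) : Matrix (Fin 2) (Fin 2) ℂ)) ∧
        ∀ y : Site (i.1.1.P i.1.2.2) (i.1.2.2 - i.1.2.1), l₀ (embIter (i.1.2.2 - i.1.2.1) y) = cf y) →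
        ∀ a' : ℝ, 0 ≤ a' →
          ∀ (v : Site (i.1.1.P i.1.2.2) 0 → Matrix (Fin 2) (Fin 2) ℂ) (z : Site (i.1.1.P i.1.2.2) (i.1.2.2 - i.1.2.1)), (∀ y, v y ≠ 0 → iterBlockOf (i.1.2.2 - i.1.2.1) y = z) →
            ∀ m : ℝ, 0 ≤ m → (∀ y, ‖v y‖ ≤ m) →
              ∀ b : PBond (i.1.1.P i.1.2.2) 0, ‖(toL2 i.1.1 i.1.2.2 (c₀ L)).symm (DL2 i.1.1 i.1.2.1 i.1.2.2 (c₀ L) U₀ (RS i.1.1 i.1.2.1 i.1.2.2 i.2.2.le (c₀ L) (cB L) U₀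
                  (GprimeP i.1.1 i.1.2.1 i.1.2.2 i.2.2.le (c₀ L) (cB L) a' U₀ (toL2S i.1.1 i.1.2.2 (c₀ L) v)))) b‖
                ≤ m * C₄ L * Real.exp (-(δ₄ L * (Site.tdist (P := i.1.1.P i.1.2.2) (iterBlockOf (i.1.2.2 - i.1.2.1) b.src) z : ℝ)))) :
    ∃ (αΔ CΔ δΔ : ℕ → ℝ),
      (∀ L : ℕ, 1 < L → 0 < αΔ L) ∧ (∀ L : ℕ, 1 < L → 10 ^ 12 * (L : ℝ) ^ 3 * αΔ L ≤ 1) ∧ (∀ L : ℕ, 1 < L → 10 ^ 10 * (L : ℝ) ^ 6 * αΔ L ≤ 1) ∧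
      (∀ L : ℕ, 1 < L → 13 * 10 ^ 14 * (L : ℝ) ^ 3 * αΔ L ≤ 1) ∧ (∀ L : ℕ, 1 < L → αΔ L ≤ 1) ∧ (∀ L : ℕ, 1 < L → 0 ≤ CΔ L) ∧ (∀ L : ℕ, 1 < L → 0 < δΔ L) ∧
    ∀ (L : ℕ), 1 < L → ∀ (i : Idx L) (U₀ : GaugeField (i.1.1.P i.1.2.2) 0 (Matrix.specialUnitaryGroup (Fin 2) ℂ)), ∀ ρ : ℝ, RegPr i.1.1 i.1.2.1 i.1.2.2 ρ U₀ → ρ ≤ αΔ L →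
        (∀ cf : Site (i.1.1.P i.1.2.2) (i.1.2.2 - i.1.2.1) → Matrix (Fin 2) (Fin 2) ℂ,
        (∀ e' : PBond (i.1.1.P i.1.2.2) (i.1.2.2 - i.1.2.1), cf e'.src = ((emlIterU (i.1.2.2 - i.1.2.1) (bgUnits i.1.1 i.1.2.2 U₀) e' : (Matrix (Fin 2) (Fin 2) ℂ)ˣ) : Matrix (Fin 2) (Fin 2) ℂ) * cf e'.tgt *
        (((emlIterU (i.1.2.2 - i.1.2.1) (bgUnits i.1.1 i.1.2.2 U₀) e')⁻¹ : (Matrix (Fin 2) (Fin 2) ℂ)ˣ) : Matrix (Fin 2) (Fin 2) ℂ)) →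
        ∃ l₀ : Site (i.1.1.P i.1.2.2) 0 → Matrix (Fin 2) (Fin 2) ℂ,
        (∀ b' : PBond (i.1.1.P i.1.2.2) 0, l₀ b'.src = ((bgUnits i.1.1 i.1.2.2 U₀ b' : (Matrix (Fin 2) (Fin 2) ℂ)ˣ) : Matrix (Fin 2) (Fin 2) ℂ) * l₀ b'.tgt * (((bgUnits i.1.1 i.1.2.2 U₀ b')⁻¹ : (Matrix (Fin 2) (Fin 2) ℂ)ˣ) : Matrix (Fin 2) (Fin 2) ℂ)) ∧
        ∀ y : Site (i.1.1.P i.1.2.2) (i.1.2.2 - i.1.2.1), l₀ (embIter (i.1.2.2 - i.1.2.1) y) = cf y) →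
      2 * (12 * i.1.1.L ^ (i.1.2.2 - i.1.2.1) + 5) ≤ (i.1.1.P i.1.2.2).sitesPerDir 0 →
      ∀ a : ℝ, a₀ * (c₀ L / cB L) * ((i.1.1.L : ℝ) ^ (i.1.2.2 - i.1.2.1)) ^ 3 ≤ a → a ≤ a₁ * (c₀ L / cB L) * ((i.1.1.L : ℝ) ^ (i.1.2.2 - i.1.2.1)) ^ 3 →
      ∀ (y : PBond (i.1.1.P i.1.2.1) 0) (Z : Matrix (Fin 2) (Fin 2) ℂ) (b' : Bond 3 (periodsT3 i.1.1 i.1.2.2)),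
        ‖NegSup.equiv (levWeight (i.1.1.L : ℝ) (((i.1.1.L : ℝ)⁻¹) ^ (i.1.2.2 - i.1.2.1)) (fun _ : Bond 3 (periodsT3 i.1.1 i.1.2.2) => i.1.2.2 - i.1.2.1) 3) (Matrix (Fin 2) (Fin 2) ℂ)
            ((currentCLM frobEquiv (fun _ : Bond 3 (periodsT3 i.1.1 i.1.2.2) × Fin 3 => i.1.2.2 - i.1.2.1) (nabla115 (((i.1.1.L : ℝ)⁻¹) ^ (i.1.2.2 - i.1.2.1)) (bgOfCfg i.1.1 i.1.2.2 U₀))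
              (DeltaEtaSlot i.1.1 i.1.2.1 i.1.2.2 (c₀ L) U₀)) ((H1f i.1.1 i.1.2.1 i.1.2.2 i.2.2.le (c₀ L) (cB L) a (DeltaPiSlotP i.1.1 i.1.2.1 i.1.2.2 i.2.2.le (c₀ L) (cB L) a) U₀) (Pi.single y Z))) b'‖
          ≤ CΔ L * Real.exp (-(δΔ L * (Site.tdist (B5Eq118OneStroke.iterBlockOf (i.1.2.2 - i.1.2.1) ((bondEquiv i.1.1 i.1.2.2).symm b').src)
              (T3LevelShift.siteShift (T3PrintedRegularOrbits.sites_eq i.1.1 i.1.2.1 i.1.2.2 i.2.2.le) y.src) : ℝ))) * ‖Z‖ := by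
  classical
  obtain ⟨αH, CH, δH, hαH, hWH12, hWH10, hWH13, hαH1, hCH, hδH, hH⟩ := h133_family_exists c₀ cB ha₀ ha₀₁
  obtain ⟨αK, c137, δK, hαK, hWK12, hWK10, hWK13, hαK1, hc137, hδK, hK⟩ := h137kpi_family_exists c₀ cB ha₀ ha₀₁
  obtain ⟨αC, C₄, δ₄, hαC, hC₄, hδ₄, hC⟩ := hC4b
  obtain ⟨αcp, γcp, hαcp, hWcp, hwincp, hγcp, hcp⟩ := hco_DeltaPiSlotP_exists c₀ cB ha₀
  -- the common rate and cap
  obtain ⟨δ, hδd⟩ : ∃ δ : ℕ → ℝ, ∀ L, δ L = min (min (δK L) (δH L / 2)) (δ₄ L / 2) := ⟨_, fun _ => rfl⟩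
  have hδ0 : ∀ L : ℕ, 1 < L → 0 < δ L := fun L hL => by rw [hδd]; exact lt_min (lt_min (hδK L hL) (half_pos (hδH L hL))) (half_pos (hδ₄ L))
  have hδK' : ∀ L : ℕ, 1 < L → δ L ≤ δK L := fun L _ => by rw [hδd]; exact (min_le_left _ _).trans (min_le_left _ _)
  have hδH' : ∀ L : ℕ, 1 < L → δ L ≤ δH L / 2 := fun L _ => by rw [hδd]; exact (min_le_left _ _).trans (min_le_right _ _)
  have hδ₄' : ∀ L : ℕ, δ L ≤ δ₄ L / 2 := fun L => by rw [hδd]; exact min_le_right _ _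
  obtain ⟨αΔ, hαΔd⟩ : ∃ α : ℕ → ℝ, ∀ L, α L = min (min (min (αH L) (αK L)) (αC L)) (αcp L) := ⟨_, fun _ => rfl⟩
  have hαΔH : ∀ L, αΔ L ≤ αH L := fun L => by rw [hαΔd]; exact ((min_le_left _ _).trans (min_le_left _ _)).trans (min_le_left _ _)
  have hαΔK : ∀ L, αΔ L ≤ αK L := fun L => by rw [hαΔd]; exact ((min_le_left _ _).trans (min_le_left _ _)).trans (min_le_right _ _)
  have hαΔC : ∀ L, αΔ L ≤ αC L := fun L => by rw [hαΔd]; exact (min_le_left _ _).trans (min_le_right _ _)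
  have hαΔcp : ∀ L, αΔ L ≤ αcp L := fun L => by rw [hαΔd]; exact min_le_right _ _
  have hαΔ0 : ∀ L : ℕ, 1 < L → 0 < αΔ L := fun L hL => by
    rw [hαΔd]; exact lt_min (lt_min (lt_min (hαH L hL) (hαK L hL)) (hαC L hL).1) (hαcp L hL)
  have hW12 : ∀ L : ℕ, 1 < L → 10 ^ 12 * (L : ℝ) ^ 3 * αΔ L ≤ 1 := fun L hL => by
    have hL0 : (0 : ℝ) < L := by exact_mod_cast lt_trans zero_lt_one hL
    exact (mul_le_mul_of_nonneg_left (hαΔH L) (by positivity)).trans (hWH12 L hL)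
  have hW10 : ∀ L : ℕ, 1 < L → 10 ^ 10 * (L : ℝ) ^ 6 * αΔ L ≤ 1 := fun L hL => by
    have hL0 : (0 : ℝ) < L := by exact_mod_cast lt_trans zero_lt_one hL
    exact (mul_le_mul_of_nonneg_left (hαΔH L) (by positivity)).trans (hWH10 L hL)
  have hW13 : ∀ L : ℕ, 1 < L → 13 * 10 ^ 14 * (L : ℝ) ^ 3 * αΔ L ≤ 1 := fun L hL => by
    have hL0 : (0 : ℝ) < L := by exact_mod_cast lt_trans zero_lt_one hL
    exact (mul_le_mul_of_nonneg_left (hαΔH L) (by positivity)).trans (hWH13 L hL)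
  -- the weighted (c4) constant at the common rate
  obtain ⟨C₄w, hC₄wd⟩ : ∃ C : ℕ → ℝ, ∀ L, C L = C₄ L * (2 * (1 + 2 / δ₄ L)) ^ 3 := ⟨_, fun _ => rfl⟩
  have hC₄w0 : ∀ L : ℕ, 1 < L → 0 ≤ C₄w L := fun L hL => by rw [hC₄wd]; have := hC₄ L hL; have := hδ₄ L; positivity
  refine ⟨αΔ, fun L => c137 L + 6 * αΔ L * (1 + Real.exp (4 * δ L)) * C₄w L * CH L, δ, hαΔ0, hW12, hW10, hW13,
    fun L hL => (hαΔH L).trans (hαH1 L hL), fun L hL => by have := hc137 L hL; have := hCH L hL; have := hC₄w0 L hL; have := (hαΔ0 L hL).le; positivity, hδ0, ?_⟩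
  intro L hL i U₀ ρ hreg hρ hlift hroom a ha₀a ha₁a y Z b'
  -- the clamped coupling function
  obtain ⟨af, haf⟩ : ∃ f : ∀ L' : ℕ, Idx L' → ℝ, ∀ (L' : ℕ) (i' : Idx L'),
      f L' i' = max (a₀ * (c₀ L' / cB L') * ((i'.1.1.L : ℝ) ^ (i'.1.2.2 - i'.1.2.1)) ^ 3) (min a (a₁ * (c₀ L' / cB L') * ((i'.1.1.L : ℝ) ^ (i'.1.2.2 - i'.1.2.1)) ^ 3)) :=
    ⟨_, fun _ _ => rfl⟩
  have ht0 : ∀ (L' : ℕ) (i' : Idx L'), 0 ≤ (c₀ L' / cB L') * ((i'.1.1.L : ℝ) ^ (i'.1.2.2 - i'.1.2.1)) ^ 3 := fun L' i' =>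
    mul_nonneg (div_nonneg (hc₀ L').out.le (hcB L').out.le) (pow_nonneg (pow_nonneg (Nat.cast_nonneg _) _) _)
  have haf_lo : ∀ (L' : ℕ) (i' : Idx L'), a₀ * (c₀ L' / cB L') * ((i'.1.1.L : ℝ) ^ (i'.1.2.2 - i'.1.2.1)) ^ 3 ≤ af L' i' := fun L' i' => by rw [haf]; exact le_max_left _ _
  have haf_hi : ∀ (L' : ℕ) (i' : Idx L'), af L' i' ≤ a₁ * (c₀ L' / cB L') * ((i'.1.1.L : ℝ) ^ (i'.1.2.2 - i'.1.2.1)) ^ 3 := fun L' i' => by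
    rw [haf]
    refine max_le ?_ (min_le_right _ _)
    have := ht0 L' i'
    rw [mul_assoc, mul_assoc]; exact mul_le_mul_of_nonneg_right ha₀₁ this
  have hafa : af L i = a := by rw [haf, min_eq_left ha₁a, max_eq_right ha₀a]
  have haf0 : ∀ (L' : ℕ) (i' : Idx L'), 0 ≤ af L' i' := fun L' i' => le_trans (by have := ht0 L' i'; rw [mul_assoc]; positivity) (haf_lo L' i')
  -- the thread `Lift ∧ ROOM`
  obtain ⟨Λ, hΛ⟩ : ∃ Λ : ∀ (L' : ℕ) (i' : Idx L'), GaugeField (i'.1.1.P i'.1.2.2) 0 (Matrix.specialUnitaryGroup (Fin 2) ℂ) → Prop, ∀ L' i' U₀', Λ L' i' U₀' ↔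
      ((∀ cf : Site (i'.1.1.P i'.1.2.2) (i'.1.2.2 - i'.1.2.1) → Matrix (Fin 2) (Fin 2) ℂ,
        (∀ e' : PBond (i'.1.1.P i'.1.2.2) (i'.1.2.2 - i'.1.2.1), cf e'.src = ((emlIterU (i'.1.2.2 - i'.1.2.1) (bgUnits i'.1.1 i'.1.2.2 U₀') e' : (Matrix (Fin 2) (Fin 2) ℂ)ˣ) : Matrix (Fin 2) (Fin 2) ℂ) * cf e'.tgt *
        (((emlIterU (i'.1.2.2 - i'.1.2.1) (bgUnits i'.1.1 i'.1.2.2 U₀') e')⁻¹ : (Matrix (Fin 2) (Fin 2) ℂ)ˣ) : Matrix (Fin 2) (Fin 2) ℂ)) →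
        ∃ l₀ : Site (i'.1.1.P i'.1.2.2) 0 → Matrix (Fin 2) (Fin 2) ℂ,
        (∀ b' : PBond (i'.1.1.P i'.1.2.2) 0, l₀ b'.src = ((bgUnits i'.1.1 i'.1.2.2 U₀' b' : (Matrix (Fin 2) (Fin 2) ℂ)ˣ) : Matrix (Fin 2) (Fin 2) ℂ) * l₀ b'.tgt * (((bgUnits i'.1.1 i'.1.2.2 U₀' b')⁻¹ : (Matrix (Fin 2) (Fin 2) ℂ)ˣ) : Matrix (Fin 2) (Fin 2) ℂ)) ∧
        ∀ y : Site (i'.1.1.P i'.1.2.2) (i'.1.2.2 - i'.1.2.1), l₀ (embIter (i'.1.2.2 - i'.1.2.1) y) = cf y) ∧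
      2 * (12 * i'.1.1.L ^ (i'.1.2.2 - i'.1.2.1) + 5) ≤ (i'.1.1.P i'.1.2.2).sitesPerDir 0) := ⟨_, fun _ _ _ => Iff.rfl⟩
  -- the window of record at each member under the cap (for `posOnto_of_coercive`)
  have hw13 : ∀ (L' : ℕ), 1 < L' → ∀ (i' : Idx L') (ρ' : ℝ), ρ' ≤ αΔ L' → 13 * 10 ^ 14 * (i'.1.1.L : ℝ) ^ 3 * ρ' ≤ 1 := by
    intro L' hL' i' ρ' hρ'
    have e : (i'.1.1.L : ℝ) = (L' : ℝ) := by rw [i'.2.1]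
    have hL0 : (0 : ℝ) < L' := by exact_mod_cast lt_trans zero_lt_one hL'
    rw [e]
    calc 13 * 10 ^ 14 * (L' : ℝ) ^ 3 * ρ' ≤ 13 * 10 ^ 14 * (L' : ℝ) ^ 3 * αΔ L' := mul_le_mul_of_nonneg_left hρ' (by positivity)
      _ ≤ 1 := hW13 L' hL'
  -- the door, BY NAME
  have key := h88_family_of_h137k_h133_c4w αΔ c₀ cB af haf0 Λ
    (fun L' hL' i' U₀' ρ' hreg' hρ' hl' => posOnto_of_coercive i'.2.2.le (cB L') i'.2.2 hreg' (hw13 L' hL' i' ρ' hρ') (hγcp L' hL') _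
      (hcp L' hL' i' U₀' ρ' hreg' (hρ'.trans (hαΔcp L')) ((hΛ L' i' U₀').mp hl').1 (af L' i') (haf_lo L' i')))
    c137 δK CH δH C₄w δ hc137 hCH (fun L' hL' => (hδ0 L' hL').le) hδK' hδH'
    (fun L' hL' i' U₀' ρ' hreg' hρ' hl' => hK L' hL' i' U₀' ρ' hreg' (hρ'.trans (hαΔK L')) ((hΛ L' i' U₀').mp hl').1 ((hΛ L' i' U₀').mp hl').2 (af L' i') (haf_lo L' i') (haf_hi L' i'))
    (fun L' hL' i' U₀' ρ' hreg' hρ' hl' => hH L' hL' i' U₀' ρ' hreg' (hρ'.trans (hαΔH L')) ((hΛ L' i' U₀').mp hl').1 ((hΛ L' i' U₀').mp hl').2 (af L' i') (haf_lo L' i') (haf_hi L' i'))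
    (fun L' hL' i' U₀' ρ' hreg' hρ' hl' => by
      have h4 := hc4w_of_hc4b i'.1.1 i'.2.2.le (c₀ L') (cB L') (af L' i') U₀' (hC₄ L' hL') (hδ₄ L') (hδ0 L' hL').le (hδ₄' L')
        (hC L' hL' i' U₀' ρ' hreg' (hρ'.trans (hαΔC L')) ((hΛ L' i' U₀').mp hl').1 (af L' i') (haf0 L' i'))
      rw [hC₄wd]
      exact h4)
    L hL i U₀ ρ hreg hρ ((hΛ L i U₀).mpr ⟨hlift, hroom⟩) y Z b'
  rw [hafa] at key
  exact key

end Summit.QuantumFields.YangMills.Theorems.Prop7H88FamilyPackage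

end
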